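import Mathlib
import Summits.NavierStokesRegularity.NavierStokesRegularity.Theorems.ScenarioCensusPeriodicSlabTerms
import HarnessLib

/-!
# Census row S7 (bounded steady flows in the periodic slab, case (d)): the dyadic energy estimate
# for `E(r) = ∫_{period ∩ {ρ<r}} |D∂₃U|²`

Support file for the scenario census of `NavierStokesRegularity` (cell `pub/ns-census`, row S7 =
Bang–Gui–Wang–Xie 2025, Thm 1.4 (d); tree FACT
`Literature.Analysis.FluidPDE.BangGuiWangXie2025_periodicSlab_liouville`, second conjunct). The
weighted inequality of `…PeriodicSlabTerms` (`dyadic_weighted_estimate`, cut-off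
`φ = cylCutoff r (2r)`, annulus indicator `χ`) is rewritten in terms of the energy function of the
printed proof, `Z(R) = ∫ |∇∂_{x₃}u|² φ_R` (arXiv:2205.13259 §5 Step 4), here
`E(r) = ∫_{zSlab L 0 ∩ {ρ < r}} |D∂₃U|²`: since `φ = 1` on `{ρ ≤ r}` and `χ ≤ 𝟙{ρ < 2r} − 𝟙{ρ < r}`,
`E(r) ≤ ∫ φ|Dw|²` and `∫ χ|Dw|² = E(2r) − E(r)`.

* `energy_dyadic_estimate` — `∃ γ a c ≥ 0`, for all `r ≥ 1`, `λ > 0`: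
  `(ν − M L/(2π)) E(r) ≤ γ (E(2r) − E(r))/r + a λ r + c (E(2r) − E(r))/(λ r)`.

* `saintVenant_dyadic` — the elementary real-variable lemma: a nondecreasing `E ≥ 0` of at most
  quadratic growth satisfying such a dyadic inequality (with `ν − M L/(2π) > 0`) vanishes
  identically; this discrete form replaces the differential inequality
  `Z(R) ≤ C R^{1/2} Z'(R)^{1/2}` of the printed proof.

The Liouville conclusion is the sequel file `…PeriodicSlabLiouville`. No summit statement and no
census row is proved in this file.

## References

* J. Bang, C. Gui, Y. Wang, C. Xie, J. Fluid Mech. 1005 (2025) A6 = arXiv:2205.13259, §5 Step 4.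
  [BangGuiWangXie2025]
-/

-- the summit and its single problem share the name (D-0017 nested layout)
set_option linter.dupNamespace false

noncomputable section

open MeasureTheory Set Function Filter InnerProductSpace
open scoped Topology ENNReal NNReal RealInnerProductSpace Laplacian ContDiff

namespace Summit.NavierStokesRegularity.NavierStokesRegularity.Theorems.ScenarioCensus.PeriodicSlab

open Literature.Analysis Literature.Analysis.FluidPDE

/-- **The dyadic energy estimate** (Bang–Gui–Wang–Xie, §5 Step 4, quantified on dyadic annuli).
Let `U` be smooth, axially `L`-periodic, divergence free, with `‖U‖ ≤ M`, `‖DU‖ ≤ K₁`,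
`‖D²U‖ ≤ K₂`; let `w = DU(·)e₃` be divergence free and solve `ν Δw = (w·∇)U + (U·∇)w + ∇q` with an
axially periodic `q ∈ C¹`, `|q| ≤ K₃`; assume `M L/(2π) ≤ ν`. Put
`E(r) = ∫_{zSlab L 0 ∩ {ρ < r}} |Dw|²`. Then there are `γ, a, c ≥ 0` with
`(ν − M L/(2π)) E(r) ≤ γ (E(2r) − E(r))/r + a λ r + c (E(2r) − E(r))/(λ r)`
for all `r ≥ 1` and `λ > 0`. -/
theorem energy_dyadic_estimate {ν L M K₁ K₂ K₃ : ℝ} (hν : 0 < ν) (hL : 0 < L)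
    (hML : M * L / (2 * Real.pi) ≤ ν)
    {U : EuclideanSpace ℝ (Fin 3) → EuclideanSpace ℝ (Fin 3)} {q : EuclideanSpace ℝ (Fin 3) → ℝ}
    (hU : ContDiff ℝ (⊤ : ℕ∞) U) (hq : ContDiff ℝ 1 q) (hdivU : VectorCalculus.IsDivFree U)
    (hdivw : VectorCalculus.IsDivFree (fun y => fderiv ℝ U y eZ))
    (hpde : ∀ x, ν • (Δ (fun y => fderiv ℝ U y eZ)) x =
      convect (fun y => fderiv ℝ U y eZ) U x + convect U (fun y => fderiv ℝ U y eZ) x +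
        gradient q x)
    (hUper : IsAxiallyPeriodic L U) (hqper : IsAxiallyPeriodic L q)
    (hM : ∀ x, ‖U x‖ ≤ M) (hK₁ : ∀ x, ‖fderiv ℝ U x‖ ≤ K₁)
    (hK₂ : ∀ x, ‖iteratedFDeriv ℝ 2 U x‖ ≤ K₂) (hK₃ : ∀ x, |q x| ≤ K₃)
    (E : ℝ → ℝ) (hE : ∀ r, E r = ∫ x in zSlab L 0 ∩ {x | cylRadius x < r},
      frobeniusNormSq (fderiv ℝ (fun y => fderiv ℝ U y eZ) x)) :
    ∃ γ a c : ℝ, 0 ≤ γ ∧ 0 ≤ a ∧ 0 ≤ c ∧ ∀ r : ℝ, 1 ≤ r → ∀ lam : ℝ, 0 < lam →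
      (ν - M * L / (2 * Real.pi)) * E r ≤
        γ * (E (2 * r) - E r) / r + a * lam * r + c * (E (2 * r) - E r) / (lam * r) := by
  obtain ⟨C₀, hC₀0, hC₀⟩ := exists_norm_fderiv_cylCutoff_le
  set w : EuclideanSpace ℝ (Fin 3) → EuclideanSpace ℝ (Fin 3) := fun y => fderiv ℝ U y eZ with hw
  set κ : ℝ := (L / (2 * Real.pi)) ^ 2 with hκ
  have hκ0 : 0 ≤ κ := sq_nonneg _
  have hM0 : 0 ≤ M := (norm_nonneg _).trans (hM 0)
  have hU2 : ContDiff ℝ 2 U := contDiff_infty.1 hU 2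
  have hwS : ContDiff ℝ ∞ w := (hU.fderiv_right (m := ∞) le_rfl).clm_apply contDiff_const
  have hw1 : ContDiff ℝ 1 w := contDiff_infty.1 hwS 1
  have hFc : Continuous fun x => frobeniusNormSq (fderiv ℝ w x) :=
    continuous_frobeniusNormSq_fderiv hw1 one_ne_zero
  have hF0 : ∀ x, 0 ≤ frobeniusNormSq (fderiv ℝ w x) := fun x => frobeniusNormSq_nonneg _
  have hF_bd : ∀ x, frobeniusNormSq (fderiv ℝ w x) ≤ 3 * K₂ ^ 2 := fun x =>
    (partial_bounds hU2 hK₂ x).2.1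
  refine ⟨C₀ * (3 * ν * (1 + κ) / 2 + 3 * M * κ / 2), 16 * C₀ * K₃ ^ 2 * L, C₀ * κ / 2,
    by positivity, by positivity, by positivity, ?_⟩
  intro r hr lam hlam
  have hr0 : 0 < r := by linarith
  have hr2 : r < 2 * r := by linarith
  have hA := dyadic_weighted_estimate hν hL hML hU hq hdivU hdivw hpde hUper hqper hM hK₁ hK₂ hK₃
    hC₀0 hC₀ hr hlam
  -- abbreviations matching the weighted inequality
  set S : Set (EuclideanSpace ℝ (Fin 3)) := zSlab L 0 with hS
  set F : EuclideanSpace ℝ (Fin 3) → ℝ := fun x => frobeniusNormSq (fderiv ℝ w x) with hF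
  set φ : EuclideanSpace ℝ (Fin 3) → ℝ := cylCutoff r (2 * r) with hφ
  set A : Set (EuclideanSpace ℝ (Fin 3)) := {x | r ≤ cylRadius x ∧ cylRadius x < 2 * r} with hAdef
  set χ : EuclideanSpace ℝ (Fin 3) → ℝ := A.indicator fun _ => (1 : ℝ) with hχ
  set Iφ : ℝ := ∫ x in S, φ x * F x with hIφ
  set D : ℝ := ∫ x in S, χ x * F x with hD
  -- cut-off facts
  have hφc : Continuous φ := (contDiff_cylCutoff r (2 * r) (n := 0)).continuous
  have hφnn : ∀ x, 0 ≤ φ x := cylCutoff_nonneg r (2 * r)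
  have hφone : ∀ x, cylRadius x ≤ r → φ x = 1 := fun x hx => cylCutoff_eq_one hr0.le hr2 hx
  have hφzero : ∀ x, 2 * r ≤ cylRadius x → φ x = 0 := fun x hx => cylCutoff_eq_zero hr0.le hr2 hx
  have hAm : MeasurableSet A :=
    (isClosed_le continuous_const continuous_cylRadius).measurableSet.inter
      (isOpen_lt continuous_cylRadius continuous_const).measurableSet
  -- integrability
  have hIφ_int : IntegrableOn (fun x => φ x * F x) S volume :=
    integrableOn_zSlab_of_eq_zero_of_le_cylRadius (Q := fun x => φ x * F x) (hφc.mul hFc)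
      (fun x hx => by show φ x * F x = 0; rw [hφzero x hx, zero_mul]) L 0
  have hF_int2 : IntegrableOn F (S ∩ {x | cylRadius x < 2 * r}) volume :=
    integrableOn_zSlab_inter_cyl_of_bound hL (by linarith) hFc (B := 3 * K₂ ^ 2) fun x => by
      rw [Real.norm_of_nonneg (hF0 x)]; exact hF_bd x
  have hmeas : MeasurableSet (S ∩ {x : EuclideanSpace ℝ (Fin 3) | cylRadius x < r}) :=
    (measurableSet_zSlab L 0).inter (isOpen_lt continuous_cylRadius continuous_const).measurableSet
  have hsub : S ∩ {x | cylRadius x < r} ⊆ S ∩ {x | cylRadius x < 2 * r} :=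
    fun x hx => ⟨hx.1, lt_trans hx.2 hr2⟩
  -- `E(r) ≤ Iφ`
  have hEr : E r ≤ Iφ := by
    rw [hE r]
    calc ∫ x in S ∩ {x | cylRadius x < r}, F x
        = ∫ x in S, (S ∩ {x | cylRadius x < r}).indicator F x := by
          rw [setIntegral_indicator hmeas, Set.inter_eq_self_of_subset_right inter_subset_left]
      _ ≤ Iφ := by
          refine setIntegral_mono_on ((hF_int2.mono_set hsub).integrable_indicator hmeas |>.integrableOn)
            hIφ_int (measurableSet_zSlab L 0) fun x _ => ?_
          by_cases hx : x ∈ S ∩ {x | cylRadius x < r}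
          · rw [Set.indicator_of_mem hx, hφone x (le_of_lt hx.2), one_mul]
          · rw [Set.indicator_of_notMem hx]; exact mul_nonneg (hφnn x) (hF0 x)
  -- `E(2r) − E(r) = D`
  have hED : E (2 * r) - E r = D := by
    rw [hE (2 * r), hE r, hD]
    have hdiff : (S ∩ {x | cylRadius x < 2 * r}) \ (S ∩ {x | cylRadius x < r}) = S ∩ A := by
      ext x
      constructor
      · rintro ⟨⟨hxS, hx2⟩, hnot⟩
        refine ⟨hxS, ?_, hx2⟩
        by_contra hlt
        exact hnot ⟨hxS, not_le.1 hlt⟩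
      · rintro ⟨hxS, h1, h2⟩
        exact ⟨⟨hxS, h2⟩, fun h => (not_lt.2 h1) h.2⟩
    rw [← setIntegral_sdiff hmeas hF_int2 hsub, hdiff, ← setIntegral_indicator hAm]
    refine setIntegral_congr_fun (measurableSet_zSlab L 0) fun x _ => ?_
    by_cases hx : x ∈ A
    · simp [hχ, hx]
    · simp [hχ, hx]
  -- conclude
  have hν' : 0 ≤ ν - M * L / (2 * Real.pi) := sub_nonneg.2 hML
  calc (ν - M * L / (2 * Real.pi)) * E r ≤ (ν - M * L / (2 * Real.pi)) * Iφ :=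
        mul_le_mul_of_nonneg_left hEr hν'
    _ ≤ C₀ * (3 * ν * (1 + κ) / 2 + 3 * M * κ / 2) * D / r + 16 * C₀ * K₃ ^ 2 * L * lam * r +
          C₀ * κ / 2 * D / (lam * r) := hA
    _ = _ := by rw [← hED]

/-! ### The elementary dyadic lemma -/

/-- **The dyadic Saint-Venant lemma** (elementary real analysis). Let `E` be nondecreasing and
nonnegative on `[1, ∞)` with at most quadratic growth, `E(r) ≤ A r²`, and suppose that for all
`r ≥ 1` and all `λ > 0`
`ν E(r) ≤ γ (E(2r) − E(r))/r + a λ r + b (E(2r) − E(r))/(λ r)` with `ν > 0`, `γ, a, b ≥ 0`.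
Then `E ≡ 0` on `[1, ∞)`. (Optimising `λ` gives `ν E(r) ≤ γ D/r + (a + b)√D`, `D = E(2r) − E(r)`;
if `E(r₀) > 0` then `D` is bounded below along the doubling sequence, so `E → ∞`, and once `E`
and `r` are large each doubling multiplies `E` by at least `5 > 2²`, contradicting quadratic
growth.) This discrete form replaces the differential inequality `Z(R) ≤ C R^{1/2} Z'(R)^{1/2}`
of Bang–Gui–Wang–Xie, §5 Step 4 ("the same argument as that for the proof of Theorem 1.3"). -/
theorem saintVenant_dyadic {E : ℝ → ℝ} {ν γ a b A : ℝ} (hν : 0 < ν) (hγ : 0 ≤ γ) (ha : 0 ≤ a)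
    (hb : 0 ≤ b) (hmono : ∀ r s, 1 ≤ r → r ≤ s → E r ≤ E s) (h0 : ∀ r, 1 ≤ r → 0 ≤ E r)
    (hA : ∀ r, 1 ≤ r → E r ≤ A * r ^ 2)
    (h : ∀ r, 1 ≤ r → ∀ lam : ℝ, 0 < lam →
      ν * E r ≤ γ * (E (2 * r) - E r) / r + a * lam * r + b * (E (2 * r) - E r) / (lam * r)) :
    ∀ r, 1 ≤ r → E r = 0 := by
  -- abbreviations
  set γ₁ : ℝ := γ + 1 with hγ₁
  set K₁ : ℝ := a + b + 1 with hK₁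
  have hγ₁0 : 0 < γ₁ := by rw [hγ₁]; linarith
  have hK₁0 : 0 < K₁ := by rw [hK₁]; linarith
  have hD0 : ∀ r, 1 ≤ r → 0 ≤ E (2 * r) - E r := fun r hr =>
    sub_nonneg.2 (hmono r (2 * r) hr (by linarith))
  -- (★) the optimised inequality `ν E(r) ≤ γ₁ D / r + K₁ √D` for `r ≥ 1`
  have star : ∀ r, 1 ≤ r →
      ν * E r ≤ γ₁ * (E (2 * r) - E r) / r + K₁ * Real.sqrt (E (2 * r) - E r) := by
    intro r hr
    have hr0 : 0 < r := by linarith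
    set D := E (2 * r) - E r with hD
    have hDnn : 0 ≤ D := hD0 r hr
    rcases hDnn.eq_or_lt with hDz | hDpos
    · -- `D = 0`: `ν E(r) ≤ a λ r` for every `λ > 0`, hence `E(r) ≤ 0`
      have hE0 : ν * E r ≤ 0 := by
        by_contra hpos
        rw [not_le] at hpos
        have hε : 0 < ν * E r / (2 * (a + 1) * r) := by positivity
        have h1 := h r hr _ hε
        rw [← hD, ← hDz] at h1
        simp only [mul_zero, zero_div, zero_add, add_zero] at h1
        have h2 : a * (ν * E r / (2 * (a + 1) * r)) * r = ν * E r * (a / (2 * (a + 1))) := by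
          field_simp
        rw [h2] at h1
        have h3 : a / (2 * (a + 1)) < 1 := by
          rw [div_lt_one (by positivity)]; linarith
        nlinarith
      rw [← hDz]
      simpa using hE0
    · -- `D > 0`: take `λ = √D / r`
      have hsq : 0 < Real.sqrt D := Real.sqrt_pos.2 hDpos
      have hlam : 0 < Real.sqrt D / r := div_pos hsq hr0
      have h1 := h r hr _ hlam
      have hDD : Real.sqrt D * Real.sqrt D = D := Real.mul_self_sqrt hDnn
      have e1 : a * (Real.sqrt D / r) * r = a * Real.sqrt D := by field_simp
      have e2 : b * D / (Real.sqrt D / r * r) = b * Real.sqrt D := by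
        rw [div_mul_cancel₀ _ hr0.ne', mul_div_assoc, Real.div_sqrt]
      rw [← hD, e1, e2] at h1
      have e3 : γ * D / r ≤ γ₁ * D / r :=
        div_le_div_of_nonneg_right (by rw [hγ₁]; nlinarith) hr0.le
      have e4 : a * Real.sqrt D + b * Real.sqrt D ≤ K₁ * Real.sqrt D := by rw [hK₁]; nlinarith
      linarith
  -- Lemma A: a positive lower bound on `D` where `E ≥ η > 0`
  have lemA : ∀ η : ℝ, 0 < η → ∀ r, 1 ≤ r → η ≤ E r →
      min (ν * η / (2 * γ₁)) ((ν * η / (2 * K₁)) ^ 2) ≤ E (2 * r) - E r := by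
    intro η hη r hr hEr
    have hr0 : 0 < r := by linarith
    set D := E (2 * r) - E r with hD
    have hDnn : 0 ≤ D := hD0 r hr
    have hs := star r hr
    rw [← hD] at hs
    by_contra hlt
    rw [not_le, lt_min_iff] at hlt
    obtain ⟨h1, h2⟩ := hlt
    have h3 : Real.sqrt D < ν * η / (2 * K₁) := by
      rw [← Real.sqrt_sq (by positivity : 0 ≤ ν * η / (2 * K₁))]
      exact Real.sqrt_lt_sqrt hDnn h2
    have h4 : γ₁ * D / r ≤ γ₁ * D := div_le_self (by positivity) hr
    have h5 : γ₁ * D < ν * η / 2 := by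
      calc γ₁ * D < γ₁ * (ν * η / (2 * γ₁)) := mul_lt_mul_of_pos_left h1 hγ₁0
        _ = ν * η / 2 := by field_simp
    have h6 : K₁ * Real.sqrt D < ν * η / 2 := by
      calc K₁ * Real.sqrt D < K₁ * (ν * η / (2 * K₁)) := mul_lt_mul_of_pos_left h3 hK₁0
        _ = ν * η / 2 := by field_simp
    have h7 : ν * η ≤ ν * E r := mul_le_mul_of_nonneg_left hEr hν.le
    linarith
  -- Lemma B: once `E` and `r` are large, doubling multiplies `E` by at least `5`
  set r₁ : ℝ := max 1 (8 * γ₁ / ν) with hr₁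
  set e₁ : ℝ := 16 * K₁ ^ 2 / ν ^ 2 with he₁
  have he₁0 : 0 < e₁ := by positivity
  have hr₁1 : 1 ≤ r₁ := le_max_left _ _
  have lemB : ∀ r, r₁ ≤ r → e₁ ≤ E r → 5 * E r ≤ E (2 * r) := by
    intro r hr hEr
    have hr1 : 1 ≤ r := le_trans hr₁1 hr
    have hr8 : 8 * γ₁ / ν ≤ r := le_trans (le_max_right _ _) hr
    have hr0 : 0 < r := by linarith
    set D := E (2 * r) - E r with hD
    have hDnn : 0 ≤ D := hD0 r hr1
    have hEpos : 0 < E r := lt_of_lt_of_le he₁0 hEr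
    have hs := star r hr1
    rw [← hD] at hs
    suffices h4D : 4 * E r ≤ D by linarith
    by_contra hlt
    rw [not_le] at hlt
    -- the linear term: `γ₁ D / r < 4 γ₁ E / r ≤ ν E / 2`
    have h1 : γ₁ * D / r < ν * E r / 2 := by
      have h1a : γ₁ * D / r < γ₁ * (4 * E r) / r :=
        div_lt_div_of_pos_right (mul_lt_mul_of_pos_left hlt hγ₁0) hr0
      have h1b : γ₁ * (4 * E r) / r ≤ γ₁ * (4 * E r) / (8 * γ₁ / ν) :=
        div_le_div_of_nonneg_left (by positivity) (by positivity) hr8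
      have h1c : γ₁ * (4 * E r) / (8 * γ₁ / ν) = ν * E r / 2 := by
        field_simp; ring
      linarith
    -- the square-root term: `K₁ √D < 2 K₁ √E ≤ ν E / 2`
    have h2 : K₁ * Real.sqrt D < ν * E r / 2 := by
      have h2a : Real.sqrt D < 2 * Real.sqrt (E r) := by
        calc Real.sqrt D < Real.sqrt (4 * E r) := Real.sqrt_lt_sqrt hDnn hlt
          _ = 2 * Real.sqrt (E r) := by
            rw [Real.sqrt_mul (by norm_num), show Real.sqrt 4 = 2 by
              rw [show (4 : ℝ) = 2 ^ 2 by norm_num, Real.sqrt_sq (by norm_num)]]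
      have h2b : 4 * K₁ ≤ ν * Real.sqrt (E r) := by
        have : Real.sqrt e₁ ≤ Real.sqrt (E r) := Real.sqrt_le_sqrt hEr
        rw [he₁, show 16 * K₁ ^ 2 / ν ^ 2 = (4 * K₁ / ν) ^ 2 by ring,
          Real.sqrt_sq (by positivity)] at this
        calc 4 * K₁ = ν * (4 * K₁ / ν) := by field_simp
          _ ≤ ν * Real.sqrt (E r) := mul_le_mul_of_nonneg_left this hν.le
      have hsE : Real.sqrt (E r) * Real.sqrt (E r) = E r := Real.mul_self_sqrt hEpos.le
      have hsE0 : 0 < Real.sqrt (E r) := Real.sqrt_pos.2 hEpos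
      calc K₁ * Real.sqrt D < K₁ * (2 * Real.sqrt (E r)) := mul_lt_mul_of_pos_left h2a hK₁0
        _ = (4 * K₁) * Real.sqrt (E r) / 2 := by ring
        _ ≤ (ν * Real.sqrt (E r)) * Real.sqrt (E r) / 2 :=
            div_le_div_of_nonneg_right (mul_le_mul_of_nonneg_right h2b hsE0.le) (by norm_num)
        _ = ν * E r / 2 := by rw [mul_assoc, hsE]
    linarith
  -- Main argument, by contradiction
  intro r₀ hr₀
  by_contra hne
  have hη : 0 < E r₀ := lt_of_le_of_ne (h0 r₀ hr₀) (Ne.symm hne)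
  set η := E r₀ with hηdef
  set δ : ℝ := min (ν * η / (2 * γ₁)) ((ν * η / (2 * K₁)) ^ 2) with hδ
  have hδ0 : 0 < δ := lt_min (by positivity) (by positivity)
  set R : ℝ := max r₀ r₁ with hR
  have hR1 : 1 ≤ R := le_trans hr₀ (le_max_left _ _)
  have hRr₁ : r₁ ≤ R := le_max_right _ _
  have hR0 : 0 < R := by linarith
  -- `E` grows at least linearly along the doubling sequence
  have claim1 : ∀ n : ℕ, η + n * δ ≤ E (2 ^ n * R) := by
    intro n
    induction n with
    | zero =>
      simp only [Nat.cast_zero, zero_mul, add_zero, pow_zero, one_mul]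
      exact hmono r₀ R hr₀ (le_max_left _ _)
    | succ n ih =>
      have hn1 : 1 ≤ (2 : ℝ) ^ n * R := by
        have : (1 : ℝ) ≤ 2 ^ n := one_le_pow₀ (by norm_num)
        nlinarith
      have hηE : η ≤ E (2 ^ n * R) := le_trans (by
        have : (0 : ℝ) ≤ n * δ := by positivity
        linarith) ih
      have hA := lemA η hη _ hn1 hηE
      rw [← hδ] at hA
      have e : (2 : ℝ) ^ (n + 1) * R = 2 * (2 ^ n * R) := by ring
      rw [e]
      push_cast
      linarith
  -- reach the threshold `e₁`
  obtain ⟨n, hn⟩ := exists_nat_ge (e₁ / δ)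
  set R₁ : ℝ := 2 ^ n * R with hR₁
  have h2n : (1 : ℝ) ≤ 2 ^ n := one_le_pow₀ (by norm_num)
  have hR₁r₁ : r₁ ≤ R₁ := le_trans hRr₁ (by rw [hR₁]; nlinarith)
  have hR₁0 : 0 < R₁ := by rw [hR₁]; positivity
  have hE₁ : e₁ ≤ E R₁ := by
    have h1 : e₁ ≤ n * δ := by
      have := (div_le_iff₀ hδ0).1 hn
      linarith
    have := claim1 n
    linarith
  have hER₁0 : 0 < E R₁ := lt_of_lt_of_le he₁0 hE₁
  -- geometric growth with ratio `5`
  have claim2 : ∀ m : ℕ, 5 ^ m * E R₁ ≤ E (2 ^ m * R₁) := by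
    intro m
    induction m with
    | zero => simp
    | succ m ih =>
      have h5m : (1 : ℝ) ≤ 5 ^ m := one_le_pow₀ (by norm_num)
      have h2m : (1 : ℝ) ≤ 2 ^ m := one_le_pow₀ (by norm_num)
      have hrm : r₁ ≤ 2 ^ m * R₁ := le_trans hR₁r₁ (by nlinarith)
      have hEm : e₁ ≤ E (2 ^ m * R₁) := le_trans hE₁ (le_trans (by nlinarith) ih)
      have hB := lemB _ hrm hEm
      have e : (2 : ℝ) ^ (m + 1) * R₁ = 2 * (2 ^ m * R₁) := by ring
      rw [e, pow_succ]
      nlinarith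
  -- versus quadratic growth
  have hquad : ∀ m : ℕ, (5 / 4 : ℝ) ^ m ≤ A * R₁ ^ 2 / E R₁ := by
    intro m
    have h2m : (1 : ℝ) ≤ 2 ^ m := one_le_pow₀ (by norm_num)
    have hm1 : 1 ≤ 2 ^ m * R₁ := by nlinarith [le_trans hr₁1 hR₁r₁]
    have h1 := (claim2 m).trans (hA _ hm1)
    rw [le_div_iff₀ hER₁0, div_pow, div_mul_eq_mul_div, div_le_iff₀ (by positivity)]
    calc 5 ^ m * E R₁ ≤ A * (2 ^ m * R₁) ^ 2 := h1
      _ = A * R₁ ^ 2 * 4 ^ m := by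
        rw [mul_pow, ← pow_mul, show (2 : ℝ) ^ (m * 2) = 4 ^ m by
          rw [mul_comm, pow_mul]; norm_num]
        ring
  obtain ⟨m, hm⟩ := pow_unbounded_of_one_lt (A * R₁ ^ 2 / E R₁) (by norm_num : (1 : ℝ) < 5 / 4)
  exact absurd (hquad m) (not_le.2 hm)

end Summit.NavierStokesRegularity.NavierStokesRegularity.Theorems.ScenarioCensus.PeriodicSlab

end
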